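import Mathlib

/-!
# CAV-R budget identity — obstruction note BN-idea6-g6-2 (hub-lb-idea-6 g6, crux `LowerEdge_ge_m4o5`)

Bookkeeping behind LAW 1 of `LENS-CENSUS-idea6-g6.md`: for a concave "truth" `e` (the ground-state energy
density as a function of the Hamiltonian along a chord) and pointwise-valid relaxation values
`R ≤ e` on the two twins, the twin pair bounds the host truth, and its GAIN over the host relaxation value
equals host error − mean twin error − concavity defect; hence gain ≤ host error − mean twin error.
Pure real arithmetic; no summit statement is touched; nothing here is a certified bound on anything.
-/

namespace Summit.Ventures.CertifiedManyBodySolver.Cruxes.LowerEdge_ge_m4o5.CavBudget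

/-- The twin-pair (concavification) bound: validity on each twin plus midpoint concavity of the truth. -/
theorem twin_pair_bound (e0 ep em Rp Rm : ℝ) (hp : Rp ≤ ep) (hm : Rm ≤ em)
    (hconc : (ep + em) / 2 ≤ e0) : (Rp + Rm) / 2 ≤ e0 := by
  linarith

/-- Budget identity: gain = host error − mean twin error − concavity defect κ := e0 − (ep+em)/2. -/
theorem gain_identity (e0 ep em R0 Rp Rm : ℝ) :
    (Rp + Rm) / 2 - R0
      = (e0 - R0) - ((ep - Rp) + (em - Rm)) / 2 - (e0 - (ep + em) / 2) := by
  ring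

/-- Budget ceiling: with κ ≥ 0 the gain is at most host error minus mean twin error. -/
theorem gain_le_error_drop (e0 ep em R0 Rp Rm : ℝ) (hconc : (ep + em) / 2 ≤ e0) :
    (Rp + Rm) / 2 - R0 ≤ (e0 - R0) - ((ep - Rp) + (em - Rm)) / 2 := by
  linarith

/-- In particular a twin pair can beat the host value only if the mean twin error is STRICTLY below the
host error by more than κ. -/
theorem no_gain_of_errors_ge (e0 ep em R0 Rp Rm : ℝ) (hconc : (ep + em) / 2 ≤ e0)
    (herr : e0 - R0 ≤ ((ep - Rp) + (em - Rm)) / 2) : (Rp + Rm) / 2 ≤ R0 := by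
  linarith

/-- The midpoint concavity hypothesis from Mathlib's `ConcaveOn` along a real chord. -/
theorem midpoint_le_of_concaveOn {e : ℝ → ℝ} (h : ConcaveOn ℝ Set.univ e) (x θ : ℝ) :
    (e (x + θ) + e (x - θ)) / 2 ≤ e x := by
  have key := h.2 (Set.mem_univ (x + θ)) (Set.mem_univ (x - θ))
    (show (0:ℝ) ≤ 1/2 by norm_num) (show (0:ℝ) ≤ 1/2 by norm_num) (by norm_num)
  have harg : (1/2 : ℝ) • (x + θ) + (1/2 : ℝ) • (x - θ) = x := by
    simp only [smul_eq_mul]; ring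
  rw [harg] at key
  simp only [smul_eq_mul] at key
  linarith

end Summit.Ventures.CertifiedManyBodySolver.Cruxes.LowerEdge_ge_m4o5.CavBudget
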